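import Summits.AtomisticToContinuum.HydrodynamicLimit.Theorems.OneFlightGossipEngineEnergyCurrentTailsLevelCensusObjects
import Literature.MathematicalPhysics.KineticTheory.HardSphereTwoTimePressure
import HarnessLib

/-!
# Gaussian statics of the level census (stub A (ii)+(iii) of the line
# `level-census-comparison`, crux `EnergyCurrentTails`, stmt-AtomisticToContinuum-9235)

Helper file of the registered stub `stub_censusLedger : CensusLedger` (objects and statement in
`…Theorems.OneFlightGossipEngineEnergyCurrentTailsLevelCensusObjects`).  It proves the two STATIC,
chaos-free inputs (ii) and (iii) of `CensusLedger` (registered helper `censusLedger_statics`): for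
continuous profiles `a₀, θ₀ > 0`, `u₀`, every `0 < σ < 1/2` and every flow family `Φ N`, with
`λ_N = localGibbsLaw σ a₀ u₀ θ₀ N (Φ N)`,

* (ii) KINETIC ENERGY: `E_{λ_N} ∑ᵢ ‖vᵢ(s)‖² ≤ (N + 1) m₂` for all `s ≥ 0`;
* (iii) GAUSSIAN TAILS with one rate `α₀ > 0`: `n_0(E) ≤ K₀ (N+1) e^{−α₀ E}` and, for `s ≥ 0`,
  `n_s(E) ≤ K₀^{N+2} e^{−α₀ E}` (`n_s(E) = levelCensus … s E = E_{λ_N} #{i : E < ‖vᵢ(s)‖²}`).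

**Proof.**  Given the positions, the local Gibbs velocities are independent Gaussians
`N(u₀(xᵢ), θ₀(xᵢ) id)` (disintegration `lintegral_localGibbsMeasure`; the position marginal has
mass one, `lintegral_posWeight_eq_one`, for `σ ≤ 1/2`).  Fernique's theorem
(`ProbabilityTheory.IsGaussian.exists_integrable_exp_sq`) gives `C > 0` with
`I_C = ∫ e^{C‖w‖²} dN(0, id) < ∞`; with `θM = max θ₀`, `U ≥ ‖u₀‖` and `α₀ = C / (2 θM)` the affine
transfer `v = u + √θ w` and `‖u + √θ w‖² ≤ 2‖u‖² + 2θ‖w‖²` give the one-body bound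
`∫ e^{α₀‖v‖²} dN(u, θ id) ≤ K = e^{2 α₀ U²} I_C` (`lintegral_exp_mul_norm_sq_gaussMeasure_le`),
whence `E_{λ_N} e^{α₀‖vᵢ‖²} ≤ K` per particle and `E_{λ_N} ∏ᵢ e^{α₀‖vᵢ‖²} ≤ K^{N+1}` (Tonelli on
the product, `lintegral_fintype_prod_eq_prod'`).  Then: (ii) `‖v‖² ≤ α₀⁻¹ e^{α₀‖v‖²}` and
conservation of `∑ᵢ‖vᵢ‖²` along the flow on the `λ_N`-conull good set
(`IsHardSphereTrajectory.configEnergy_eq_holds`, `ae_mem_good_localGibbsLaw`), `m₂ = K / α₀`;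
(iii) Chernoff `𝟙{E < ‖v‖²} ≤ e^{α₀(‖v‖² − E)}` at `s = 0` (`Φ_0 = id` on the good set), and for
`s ≥ 0` the pathwise bound `#{i : E < ‖vᵢ(s)‖²} ≤ (N+1) 𝟙{E < ∑ⱼ‖vⱼ(s)‖²} = (N+1) 𝟙{E < ∑ⱼ‖vⱼ(0)‖²}`
`≤ (N+1) e^{−α₀E} ∏ⱼ e^{α₀‖vⱼ(0)‖²}`, with `K₀ = 2 max(K, 1)` (`(N+1) K^{N+1} ≤ K₀^{N+2}`).

References: Spohn 1991 Part I §2.3 (local equilibrium states); Fernique 1970 (Gaussian vectors);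
Cercignani–Illner–Pulvirenti 1994 §4.2 (energy conservation along hard-sphere trajectories).
-/

noncomputable section

open MeasureTheory Set Filter
open scoped ENNReal

namespace Summit.AtomisticToContinuum.HydrodynamicLimit.Theorems.EnergyCurrentTailsLevelCensus

open Literature.MathematicalPhysics.KineticTheory Literature.Analysis.FluidPDE

/-! ## One-body Gaussian exponential moments -/

/-- The affine Gaussian map expands squares by at most a factor two:
`‖u + √θ w‖² ≤ 2‖u‖² + 2θ‖w‖²` (`θ ≥ 0`). [folklore] -/
theorem norm_add_sqrt_smul_sq_le (u w : V3) {θ : ℝ} (hθ : 0 ≤ θ) :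
    ‖u + Real.sqrt θ • w‖ ^ 2 ≤ 2 * ‖u‖ ^ 2 + 2 * θ * ‖w‖ ^ 2 := by
  have h1 : ‖u + Real.sqrt θ • w‖ ≤ ‖u‖ + Real.sqrt θ * ‖w‖ := by
    calc ‖u + Real.sqrt θ • w‖ ≤ ‖u‖ + ‖Real.sqrt θ • w‖ := norm_add_le _ _
      _ = ‖u‖ + Real.sqrt θ * ‖w‖ := by rw [norm_smul, Real.norm_of_nonneg (Real.sqrt_nonneg θ)]
  have hsq : Real.sqrt θ ^ 2 = θ := Real.sq_sqrt hθ
  calc ‖u + Real.sqrt θ • w‖ ^ 2 ≤ (‖u‖ + Real.sqrt θ * ‖w‖) ^ 2 :=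
        pow_le_pow_left₀ (norm_nonneg _) h1 2
    _ ≤ 2 * ‖u‖ ^ 2 + 2 * (Real.sqrt θ * ‖w‖) ^ 2 := by
        nlinarith [sq_nonneg (‖u‖ - Real.sqrt θ * ‖w‖)]
    _ = 2 * ‖u‖ ^ 2 + 2 * θ * ‖w‖ ^ 2 := by rw [mul_pow, hsq]; ring

/-- **One-body Gaussian exponential moment.**  If `e^{C‖w‖²}` is integrable for the standard
Gaussian on `ℝ³`, then for `0 ≤ θ`, `2 α θ ≤ C`, `0 ≤ α` and `‖u‖ ≤ U`:
`∫ e^{α‖v‖²} N(u, θ id)(dv) ≤ e^{2αU²} ∫ e^{C‖w‖²} N(0, id)(dw)` — transfer to the standard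
Gaussian (`gaussMeasure u θ = (w ↦ u + √θ w)_* N(0, id)`) and `norm_add_sqrt_smul_sq_le`.
[folklore] -/
theorem lintegral_exp_mul_norm_sq_gaussMeasure_le {C α U θ : ℝ} (u : V3)
    (hC : Integrable (fun w : V3 => Real.exp (C * ‖w‖ ^ 2)) (ProbabilityTheory.stdGaussian V3))
    (hα : 0 ≤ α) (hθ : 0 ≤ θ) (hαθ : 2 * α * θ ≤ C) (hU : ‖u‖ ≤ U) :
    ∫⁻ v, ENNReal.ofReal (Real.exp (α * ‖v‖ ^ 2)) ∂gaussMeasure u θ ≤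
      ENNReal.ofReal (Real.exp (2 * α * U ^ 2) *
        ∫ w, Real.exp (C * ‖w‖ ^ 2) ∂ProbabilityTheory.stdGaussian V3) := by
  have hm : Measurable fun v : V3 => ENNReal.ofReal (Real.exp (α * ‖v‖ ^ 2)) :=
    (Real.measurable_exp.comp ((measurable_norm.pow_const 2).const_mul α)).ennreal_ofReal
  have hmC : Measurable fun w : V3 => ENNReal.ofReal (Real.exp (C * ‖w‖ ^ 2)) :=
    (Real.measurable_exp.comp ((measurable_norm.pow_const 2).const_mul C)).ennreal_ofReal
  have hU2 : ‖u‖ ^ 2 ≤ U ^ 2 := pow_le_pow_left₀ (norm_nonneg _) hU 2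
  rw [gaussMeasure, lintegral_map hm (measurable_gaussShift u θ)]
  calc ∫⁻ w, ENNReal.ofReal (Real.exp (α * ‖u + Real.sqrt θ • w‖ ^ 2))
        ∂ProbabilityTheory.stdGaussian V3
      ≤ ∫⁻ w, ENNReal.ofReal (Real.exp (2 * α * U ^ 2)) *
          ENNReal.ofReal (Real.exp (C * ‖w‖ ^ 2)) ∂ProbabilityTheory.stdGaussian V3 := by
        refine lintegral_mono fun w => ?_
        rw [← ENNReal.ofReal_mul (Real.exp_pos _).le, ← Real.exp_add]
        refine ENNReal.ofReal_le_ofReal (Real.exp_le_exp.2 ?_)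
        have h1 : α * ‖u + Real.sqrt θ • w‖ ^ 2 ≤ α * (2 * ‖u‖ ^ 2 + 2 * θ * ‖w‖ ^ 2) :=
          mul_le_mul_of_nonneg_left (norm_add_sqrt_smul_sq_le u w hθ) hα
        have h2 : 2 * α * θ * ‖w‖ ^ 2 ≤ C * ‖w‖ ^ 2 :=
          mul_le_mul_of_nonneg_right hαθ (sq_nonneg _)
        nlinarith
    _ = ENNReal.ofReal (Real.exp (2 * α * U ^ 2)) *
          ∫⁻ w, ENNReal.ofReal (Real.exp (C * ‖w‖ ^ 2)) ∂ProbabilityTheory.stdGaussian V3 :=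
        lintegral_const_mul _ hmC
    _ = _ := by
        rw [← ofReal_integral_eq_lintegral_ofReal hC (ae_of_all _ fun w => (Real.exp_pos _).le),
          ← ENNReal.ofReal_mul (Real.exp_pos _).le]

/-! ## Exponential velocity moments under the local Gibbs law -/

/-- **Disintegration bound.**  If a measurable velocity functional `g ≥ 0` has conditional
expectation `∫ g d(⊗ᵢ N(u₀(xᵢ), θ₀(xᵢ) id)) ≤ B` for every position configuration `x`, then
`E_{λ_N} g(v) ≤ B` (`σ ≤ 1/2`): disintegrate `λ_N` into positions and independent Gaussian
velocities (`lintegral_localGibbsMeasure`); the position marginal has mass one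
(`lintegral_posWeight_eq_one`). [folklore] -/
theorem lintegral_vel_localGibbsLaw_le {a₀ θ₀ : T3 → ℝ} {u₀ : T3 → V3}
    (ha : Continuous a₀) (hθ : Continuous θ₀) (hu : Continuous u₀)
    (ha0 : ∀ x, 0 < a₀ x) (hθ0 : ∀ x, 0 < θ₀ x) {N : ℕ} {g : (Fin (N + 1) → V3) → ℝ≥0∞}
    (hg : Measurable g) {B : ℝ≥0∞} (hB : ∀ x : Fin (N + 1) → T3, ∫⁻ v, g v ∂velMeasure u₀ θ₀ x ≤ B)
    {σ : ℝ} (hσ2 : σ ≤ 1 / 2) (Φ : Flow σ N) :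
    ∫⁻ z, g (fun i => (z i).2) ∂(localGibbsLaw σ a₀ u₀ θ₀ N Φ) ≤ B := by
  have ha0' : ∀ x, 0 ≤ a₀ x := fun x => (ha0 x).le
  haveI := isProbabilityMeasure_localGibbsMeasure ha hθ hu ha0 hθ0 hσ2 N
  have hG : Measurable fun z : Config (N + 1) (Fin 3) T3 => g fun i => (z i).2 :=
    hg.comp (measurable_pi_lambda _ fun i => (measurable_pi_apply i).snd)
  have hZm : Measurable fun x : Fin (N + 1) → T3 => ENNReal.ofReal
      ((canonicalPartition (Torus.geometry (Fin 3)) (hsDiameter σ N) (N + 1)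
        (localGibbsProfile a₀ u₀ θ₀))⁻¹ * posWeight a₀ (hsDiameter σ N) (N + 1) x) :=
    ((measurable_posWeight ha _ _).const_mul _).ennreal_ofReal
  rw [localGibbsLaw_eq, lintegral_localGibbsMeasure ha hθ hu ha0' hθ0 σ N hG]
  simp only [zipConfig_apply]
  refine (lintegral_mono fun x => mul_le_mul_right (hB x) _).trans_eq ?_
  rw [lintegral_mul_const _ hZm, lintegral_posWeight_eq_one ha hθ hu ha0' hθ0 σ N, one_mul]

/-- **Exponential velocity moments under the local Gibbs law.**  If the one-body bound
`∫ e^{α‖v‖²} dN(u₀(x), θ₀(x) id) ≤ K` holds uniformly in `x ∈ 𝕋³`, then for `σ ≤ 1/2`: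
`E_{λ_N} e^{α‖vᵢ‖²} ≤ K` for every particle `i` (`measurePreserving_eval`), and
`E_{λ_N} ∏ᵢ e^{α‖vᵢ‖²} ≤ K^{N+1}` — given the positions the velocities are INDEPENDENT Gaussians
(`velMeasure` is a product measure; Tonelli `lintegral_fintype_prod_eq_prod'`). [folklore] -/
theorem lintegral_exp_mul_norm_sq_localGibbsLaw_le {a₀ θ₀ : T3 → ℝ} {u₀ : T3 → V3}
    (ha : Continuous a₀) (hθ : Continuous θ₀) (hu : Continuous u₀)
    (ha0 : ∀ x, 0 < a₀ x) (hθ0 : ∀ x, 0 < θ₀ x) {α : ℝ} {K : ℝ≥0∞}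
    (hK : ∀ x : T3, ∫⁻ v, ENNReal.ofReal (Real.exp (α * ‖v‖ ^ 2)) ∂gaussMeasure (u₀ x) (θ₀ x) ≤ K)
    {σ : ℝ} (hσ2 : σ ≤ 1 / 2) (N : ℕ) (Φ : Flow σ N) :
    (∀ i : Fin (N + 1), ∫⁻ z, ENNReal.ofReal (Real.exp (α * ‖(z i).2‖ ^ 2))
        ∂(localGibbsLaw σ a₀ u₀ θ₀ N Φ) ≤ K) ∧
      ∫⁻ z, ∏ i : Fin (N + 1), ENNReal.ofReal (Real.exp (α * ‖(z i).2‖ ^ 2))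
        ∂(localGibbsLaw σ a₀ u₀ θ₀ N Φ) ≤ K ^ (N + 1) := by
  have hg : Measurable fun w : V3 => ENNReal.ofReal (Real.exp (α * ‖w‖ ^ 2)) :=
    (Real.measurable_exp.comp ((measurable_norm.pow_const 2).const_mul α)).ennreal_ofReal
  refine ⟨fun i => ?_, ?_⟩
  · refine lintegral_vel_localGibbsLaw_le ha hθ hu ha0 hθ0 (g := fun v : Fin (N + 1) → V3 =>
      ENNReal.ofReal (Real.exp (α * ‖v i‖ ^ 2))) (hg.comp (measurable_pi_apply i)) (fun x => ?_)
      hσ2 Φ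
    have hmp : MeasurePreserving (Function.eval i) (velMeasure u₀ θ₀ x)
        (gaussMeasure (u₀ (x i)) (θ₀ (x i))) := by
      unfold velMeasure
      exact measurePreserving_eval _ i
    calc ∫⁻ v, ENNReal.ofReal (Real.exp (α * ‖v i‖ ^ 2)) ∂velMeasure u₀ θ₀ x
        = ∫⁻ w, ENNReal.ofReal (Real.exp (α * ‖w‖ ^ 2)) ∂gaussMeasure (u₀ (x i)) (θ₀ (x i)) :=
          hmp.lintegral_comp hg
      _ ≤ K := hK (x i)
  · refine lintegral_vel_localGibbsLaw_le ha hθ hu ha0 hθ0 (g := fun v : Fin (N + 1) → V3 =>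
      ∏ i : Fin (N + 1), ENNReal.ofReal (Real.exp (α * ‖v i‖ ^ 2)))
      (Finset.measurable_prod _ fun i _ => hg.comp (measurable_pi_apply i)) (fun x => ?_) hσ2 Φ
    unfold velMeasure
    rw [lintegral_fintype_prod_eq_prod' (fun i => gaussMeasure (u₀ (x i)) (θ₀ (x i)))
      (f := fun _ w => ENNReal.ofReal (Real.exp (α * ‖w‖ ^ 2))) fun _ => hg]
    calc ∏ i : Fin (N + 1), ∫⁻ w, ENNReal.ofReal (Real.exp (α * ‖w‖ ^ 2))
          ∂gaussMeasure (u₀ (x i)) (θ₀ (x i))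
        ≤ ∏ _i : Fin (N + 1), K := Finset.prod_le_prod' fun i _ => hK (x i)
      _ = K ^ (N + 1) := by rw [Finset.prod_const, Finset.card_univ, Fintype.card_fin]

/-- **The exponential velocity moments of local Gibbs data (Fernique + disintegration).**  For
continuous profiles `a₀, θ₀ > 0`, `u₀` there are `α₀ > 0` and `K ≥ 1` such that for every
`σ ≤ 1/2`, every `N` and every flow `Φ`: `E_{λ_N} e^{α₀‖vᵢ‖²} ≤ K` for every particle `i`, and
`E_{λ_N} ∏ᵢ e^{α₀‖vᵢ‖²} ≤ K^{N+1}`.  (`α₀ = C/(2 max θ₀)` with Fernique's constant `C` of the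
standard Gaussian on `ℝ³`, `K = max(e^{2α₀U²} ∫ e^{C‖w‖²} dN(0,id), 1)`, `U ≥ ‖u₀‖`.) [folklore] -/
theorem exists_expMoment_localGibbsLaw {a₀ θ₀ : T3 → ℝ} {u₀ : T3 → V3}
    (ha : Continuous a₀) (hθ : Continuous θ₀) (hu : Continuous u₀)
    (ha0 : ∀ x, 0 < a₀ x) (hθ0 : ∀ x, 0 < θ₀ x) :
    ∃ α₀ : ℝ, 0 < α₀ ∧ ∃ K : ℝ, 1 ≤ K ∧ ∀ (σ : ℝ), σ ≤ 1 / 2 → ∀ (N : ℕ) (Φ : Flow σ N),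
      (∀ i : Fin (N + 1), ∫⁻ z, ENNReal.ofReal (Real.exp (α₀ * ‖(z i).2‖ ^ 2))
          ∂(localGibbsLaw σ a₀ u₀ θ₀ N Φ) ≤ ENNReal.ofReal K) ∧
      ∫⁻ z, ∏ i : Fin (N + 1), ENNReal.ofReal (Real.exp (α₀ * ‖(z i).2‖ ^ 2))
          ∂(localGibbsLaw σ a₀ u₀ θ₀ N Φ) ≤ ENNReal.ofReal (K ^ (N + 1)) := by
  -- Fernique for the standard Gaussian on `ℝ³`
  obtain ⟨C, hC, hint⟩ :=
    ProbabilityTheory.IsGaussian.exists_integrable_exp_sq (ProbabilityTheory.stdGaussian V3)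
  -- extrema of the continuous profiles on the compact torus
  obtain ⟨xM, -, hxM⟩ := isCompact_univ.exists_isMaxOn univ_nonempty hθ.continuousOn
  obtain ⟨U, hU⟩ : ∃ U : ℝ, ∀ x, ‖u₀ x‖ ≤ U := by
    obtain ⟨B, hB⟩ := isCompact_univ.exists_bound_of_continuousOn hu.continuousOn
    exact ⟨B, fun x => hB x (mem_univ x)⟩
  have hmax : ∀ y, θ₀ y ≤ θ₀ xM := fun y => hxM (mem_univ y)
  have hθM : 0 < θ₀ xM := hθ0 xM
  set α₀ : ℝ := C / (2 * θ₀ xM) with hα₀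
  have hα₀pos : 0 < α₀ := div_pos hC (by positivity)
  set K : ℝ := max (Real.exp (2 * α₀ * U ^ 2) *
    ∫ w, Real.exp (C * ‖w‖ ^ 2) ∂ProbabilityTheory.stdGaussian V3) 1 with hK
  have hone : ∀ x : T3, ∫⁻ v, ENNReal.ofReal (Real.exp (α₀ * ‖v‖ ^ 2)) ∂gaussMeasure (u₀ x) (θ₀ x)
      ≤ ENNReal.ofReal K := by
    intro x
    refine (lintegral_exp_mul_norm_sq_gaussMeasure_le (u₀ x) hint hα₀pos.le (hθ0 x).le ?_
      (hU x)).trans (ENNReal.ofReal_le_ofReal (le_max_left _ _))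
    calc 2 * α₀ * θ₀ x ≤ 2 * α₀ * θ₀ xM := mul_le_mul_of_nonneg_left (hmax x) (by positivity)
      _ = C := by rw [hα₀]; field_simp
  refine ⟨α₀, hα₀pos, K, le_max_right _ _, fun σ hσ2 N Φ => ?_⟩
  rw [ENNReal.ofReal_pow (zero_le_one.trans (le_max_right _ _))]
  exact lintegral_exp_mul_norm_sq_localGibbsLaw_le ha hθ hu ha0 hθ0 hone hσ2 N Φ

/-! ## Pointwise inequalities -/

/-- Chernoff's pointwise bound for the level indicator: `𝟙{E < ‖v‖²} ≤ e^{−αE} e^{α‖v‖²}` in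
`ℝ≥0∞` (`α ≥ 0`). [folklore] -/
theorem indicator_level_le_exp {α : ℝ} (hα : 0 ≤ α) (E : ℝ) (v : V3) :
    Set.indicator {v : V3 | E < ‖v‖ ^ 2} (fun _ => (1 : ℝ≥0∞)) v ≤
      ENNReal.ofReal (Real.exp (-α * E)) * ENNReal.ofReal (Real.exp (α * ‖v‖ ^ 2)) := by
  by_cases hv : E < ‖v‖ ^ 2
  · rw [Set.indicator_of_mem (show v ∈ {v : V3 | E < ‖v‖ ^ 2} from hv),
      ← ENNReal.ofReal_mul (Real.exp_pos _).le, ← Real.exp_add]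
    refine ENNReal.one_le_ofReal.2 (Real.one_le_exp ?_)
    nlinarith
  · rw [Set.indicator_of_notMem (show v ∉ {v : V3 | E < ‖v‖ ^ 2} from hv)]
    exact bot_le

/-- `x ≤ α⁻¹ e^{αx}` for `α > 0` (from `αx + 1 ≤ e^{αx}`), in the `ℝ≥0∞` form used for the
kinetic energy. [folklore] -/
theorem ofReal_le_inv_mul_exp {α : ℝ} (hα : 0 < α) (x : ℝ) :
    ENNReal.ofReal x ≤ ENNReal.ofReal α⁻¹ * ENNReal.ofReal (Real.exp (α * x)) := by
  rw [← ENNReal.ofReal_mul (inv_nonneg.2 hα.le)]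
  refine ENNReal.ofReal_le_ofReal ?_
  rw [inv_mul_eq_div, le_div_iff₀ hα]
  nlinarith [Real.add_one_le_exp (α * x)]

/-- On the good set the total kinetic energy `∑ᵢ ‖vᵢ(r)‖²` is conserved
(`IsHardSphereTrajectory.configEnergy_eq_holds`, `Φ_0 = id`). [folklore] -/
theorem sum_norm_sq_flow_eq {N : ℕ} {ε : ℝ} (Φ : HardSphereFlow (Torus.geometry (Fin 3)) ε (N + 1))
    {z : Config (N + 1) (Fin 3) T3} (hz : z ∈ Φ.good) (r : ℝ) :
    ∑ i, ‖(Φ.flow r z i).2‖ ^ 2 = ∑ i, ‖(z i).2‖ ^ 2 := by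
  have h := IsHardSphereTrajectory.configEnergy_eq_holds (Φ.isTrajectory z hz) r 0
  simp only [configEnergy] at h
  rw [Φ.flow_zero z hz] at h
  linarith

/-- **Pathwise total-energy domination of the level count.**  On the good set,
`#{i : E < ‖vᵢ(r)‖²} ≤ (N+1) e^{−αE} ∏ⱼ e^{α‖vⱼ(0)‖²}` (`α ≥ 0`): a particle above the level puts
the (conserved) total energy above the level, and Chernoff. [folklore] -/
theorem levelCount_flow_le_prod_exp {N : ℕ} {ε : ℝ}
    (Φ : HardSphereFlow (Torus.geometry (Fin 3)) ε (N + 1)) {z : Config (N + 1) (Fin 3) T3}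
    (hz : z ∈ Φ.good) {α : ℝ} (hα : 0 ≤ α) (E r : ℝ) :
    (∑ i : Fin (N + 1),
        Set.indicator {v : V3 | E < ‖v‖ ^ 2} (fun _ => (1 : ℝ≥0∞)) ((Φ.flow r z i).2))
      ≤ ((N + 1 : ℕ) : ℝ≥0∞) * (ENNReal.ofReal (Real.exp (-α * E)) *
          ∏ j : Fin (N + 1), ENNReal.ofReal (Real.exp (α * ‖(z j).2‖ ^ 2))) := by
  have hE := sum_norm_sq_flow_eq Φ hz r
  -- each term is bounded by the total-energy Chernoff factor
  have hterm : ∀ i : Fin (N + 1),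
      Set.indicator {v : V3 | E < ‖v‖ ^ 2} (fun _ => (1 : ℝ≥0∞)) ((Φ.flow r z i).2) ≤
        ENNReal.ofReal (Real.exp (-α * E)) *
          ∏ j : Fin (N + 1), ENNReal.ofReal (Real.exp (α * ‖(z j).2‖ ^ 2)) := by
    intro i
    by_cases hv : E < ‖(Φ.flow r z i).2‖ ^ 2
    · rw [Set.indicator_of_mem (show (Φ.flow r z i).2 ∈ {v : V3 | E < ‖v‖ ^ 2} from hv),
        ← ENNReal.ofReal_prod_of_nonneg fun j _ => (Real.exp_pos _).le, ← Real.exp_sum,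
        ← ENNReal.ofReal_mul (Real.exp_pos _).le, ← Real.exp_add, ← Finset.mul_sum]
      refine ENNReal.one_le_ofReal.2 (Real.one_le_exp ?_)
      have hle : ‖(Φ.flow r z i).2‖ ^ 2 ≤ ∑ j, ‖(Φ.flow r z j).2‖ ^ 2 :=
        Finset.single_le_sum (fun j _ => sq_nonneg ‖(Φ.flow r z j).2‖) (Finset.mem_univ i)
      rw [hE] at hle
      nlinarith
    · rw [Set.indicator_of_notMem (show (Φ.flow r z i).2 ∉ {v : V3 | E < ‖v‖ ^ 2} from hv)]
      exact bot_le
  calc (∑ i : Fin (N + 1),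
        Set.indicator {v : V3 | E < ‖v‖ ^ 2} (fun _ => (1 : ℝ≥0∞)) ((Φ.flow r z i).2))
      ≤ ∑ _i : Fin (N + 1), ENNReal.ofReal (Real.exp (-α * E)) *
          ∏ j : Fin (N + 1), ENNReal.ofReal (Real.exp (α * ‖(z j).2‖ ^ 2)) :=
        Finset.sum_le_sum fun i _ => hterm i
    _ = _ := by
        rw [Finset.sum_const, Finset.card_univ, Fintype.card_fin, nsmul_eq_mul]

/-! ## The registered helper: kinetic energy and Gaussian tails of the census -/

/-- **Registered helper `censusLedger_statics` — stub A (ii) + (iii).**  For continuous profiles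
`a₀, θ₀ > 0`, `u₀`, every `0 < σ < 1/2` and every flow family `Φ N`:
(ii) `kineticEnergy … s ≤ (N+1) m₂` for `s ≥ 0` (`m₂ = K/α₀`: `‖v‖² ≤ α₀⁻¹e^{α₀‖v‖²}`, the
per-particle exponential moment, and conservation of `∑ᵢ‖vᵢ‖²` on the conull good set);
(iii) with the rate `α₀` of `exists_expMoment_localGibbsLaw` and `K₀ = 2 max(K, 1)`:
`levelCensus … 0 E ≤ K₀ (N+1) e^{−α₀E}` (Chernoff per particle, `Φ_0 = id` a.e.) and
`levelCensus … s E ≤ K₀^{N+2} e^{−α₀E}` for `s ≥ 0` (the total energy dominates every particle and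
is conserved; its exponential moment is `≤ K^{N+1}`, and `(N+1) K^{N+1} ≤ K₀^{N+2}`). [folklore] -/
theorem censusLedger_statics :
    ∀ (a₀ θ₀ : T3 → ℝ) (u₀ : T3 → V3), Continuous a₀ → Continuous θ₀ → Continuous u₀ →
      (∀ x, 0 < a₀ x) → (∀ x, 0 < θ₀ x) → ∀ σ : ℝ, 0 < σ → σ < 1 / 2 →
        ∀ Φ : (N : ℕ) → Flow σ N,
          (∃ m₂ : ℝ, 0 < m₂ ∧ ∀ (N : ℕ) (s : ℝ), 0 ≤ s →
              kineticEnergy σ a₀ θ₀ u₀ N (Φ N) s ≤ ENNReal.ofReal (((N : ℝ) + 1) * m₂)) ∧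
          (∃ α₀ : ℝ, 0 < α₀ ∧ ∃ K₀ : ℝ, 0 < K₀ ∧ ∀ (N : ℕ) (E : ℝ),
              levelCensus σ a₀ θ₀ u₀ N (Φ N) 0 E
                  ≤ ENNReal.ofReal (K₀ * ((N : ℝ) + 1) * Real.exp (-α₀ * E)) ∧
              ∀ s : ℝ, 0 ≤ s → levelCensus σ a₀ θ₀ u₀ N (Φ N) s E
                ≤ ENNReal.ofReal (K₀ ^ (N + 2) * Real.exp (-α₀ * E))) := by
  intro a₀ θ₀ u₀ ha hθ hu ha0 hθ0 σ _hσ hσ2 Φ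
  have hσ2' : σ ≤ 1 / 2 := hσ2.le
  obtain ⟨α₀, hα₀, K, hK1, hmom⟩ := exists_expMoment_localGibbsLaw ha hθ hu ha0 hθ0
  have hK0 : 0 ≤ K := zero_le_one.trans hK1
  have hN : ∀ N : ℕ, ((N + 1 : ℕ) : ℝ≥0∞) = ENNReal.ofReal ((N : ℝ) + 1) := fun N => by
    rw [show ((N : ℝ) + 1) = ((N + 1 : ℕ) : ℝ) by push_cast; ring, ENNReal.ofReal_natCast]
  have hmeas1 : ∀ (N : ℕ) (i : Fin (N + 1)), Measurable fun z : Config (N + 1) (Fin 3) T3 =>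
      ENNReal.ofReal (Real.exp (α₀ * ‖(z i).2‖ ^ 2)) := fun N i =>
    (Real.measurable_exp.comp ((measurable_norm.pow_const 2).const_mul α₀)).ennreal_ofReal.comp
      (measurable_pi_apply i).snd
  refine ⟨⟨K / α₀, div_pos (zero_lt_one.trans_le hK1) hα₀, fun N s _ => ?_⟩,
    ⟨α₀, hα₀, 2 * max K 1, by positivity, fun N E => ⟨?_, fun s _ => ?_⟩⟩⟩
  · -- (ii) kinetic energy
    obtain ⟨hpart, -⟩ := hmom σ hσ2' N (Φ N)
    calc kineticEnergy σ a₀ θ₀ u₀ N (Φ N) s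
        = ∫⁻ z, ENNReal.ofReal (∑ i, ‖(z i).2‖ ^ 2) ∂(localGibbsLaw σ a₀ u₀ θ₀ N (Φ N)) := by
          refine lintegral_congr_ae ?_
          filter_upwards [ae_mem_good_localGibbsLaw σ a₀ u₀ θ₀ N (Φ N)] with z hz
          rw [sum_norm_sq_flow_eq (Φ N) hz s]
      _ ≤ ∫⁻ z, ∑ i, ENNReal.ofReal α₀⁻¹ * ENNReal.ofReal (Real.exp (α₀ * ‖(z i).2‖ ^ 2))
            ∂(localGibbsLaw σ a₀ u₀ θ₀ N (Φ N)) := by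
          refine lintegral_mono fun z => ?_
          rw [ENNReal.ofReal_sum_of_nonneg fun i _ => sq_nonneg _]
          exact Finset.sum_le_sum fun i _ => ofReal_le_inv_mul_exp hα₀ _
      _ = ∑ i, ENNReal.ofReal α₀⁻¹ * ∫⁻ z, ENNReal.ofReal (Real.exp (α₀ * ‖(z i).2‖ ^ 2))
            ∂(localGibbsLaw σ a₀ u₀ θ₀ N (Φ N)) := by
          rw [lintegral_finsetSum _ fun i _ => (hmeas1 N i).const_mul _]
          exact Finset.sum_congr rfl fun i _ => lintegral_const_mul _ (hmeas1 N i)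
      _ ≤ ∑ _i : Fin (N + 1), ENNReal.ofReal α₀⁻¹ * ENNReal.ofReal K :=
          Finset.sum_le_sum fun i _ => mul_le_mul_right (hpart i) _
      _ = ENNReal.ofReal (((N : ℝ) + 1) * (K / α₀)) := by
          rw [Finset.sum_const, Finset.card_univ, Fintype.card_fin, nsmul_eq_mul, hN,
            ← ENNReal.ofReal_mul (inv_nonneg.2 hα₀.le), ← ENNReal.ofReal_mul (by positivity)]
          congr 1
          rw [div_eq_inv_mul]
  · -- (iii) the census of the datum
    obtain ⟨hpart, -⟩ := hmom σ hσ2' N (Φ N)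
    calc levelCensus σ a₀ θ₀ u₀ N (Φ N) 0 E
        = ∫⁻ z, ∑ i, Set.indicator {v : V3 | E < ‖v‖ ^ 2} (fun _ => (1 : ℝ≥0∞)) ((z i).2)
            ∂(localGibbsLaw σ a₀ u₀ θ₀ N (Φ N)) := by
          refine lintegral_congr_ae ?_
          filter_upwards [ae_mem_good_localGibbsLaw σ a₀ u₀ θ₀ N (Φ N)] with z hz
          rw [(Φ N).flow_zero z hz]
      _ ≤ ∫⁻ z, ∑ i, ENNReal.ofReal (Real.exp (-α₀ * E)) *
            ENNReal.ofReal (Real.exp (α₀ * ‖(z i).2‖ ^ 2)) ∂(localGibbsLaw σ a₀ u₀ θ₀ N (Φ N)) :=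
          lintegral_mono fun z => Finset.sum_le_sum fun i _ => indicator_level_le_exp hα₀.le E _
      _ = ∑ i, ENNReal.ofReal (Real.exp (-α₀ * E)) *
            ∫⁻ z, ENNReal.ofReal (Real.exp (α₀ * ‖(z i).2‖ ^ 2))
              ∂(localGibbsLaw σ a₀ u₀ θ₀ N (Φ N)) := by
          rw [lintegral_finsetSum _ fun i _ => (hmeas1 N i).const_mul _]
          exact Finset.sum_congr rfl fun i _ => lintegral_const_mul _ (hmeas1 N i)
      _ ≤ ∑ _i : Fin (N + 1), ENNReal.ofReal (Real.exp (-α₀ * E)) * ENNReal.ofReal K :=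
          Finset.sum_le_sum fun i _ => mul_le_mul_right (hpart i) _
      _ = ENNReal.ofReal (K * ((N : ℝ) + 1) * Real.exp (-α₀ * E)) := by
          rw [Finset.sum_const, Finset.card_univ, Fintype.card_fin, nsmul_eq_mul, hN,
            ← ENNReal.ofReal_mul (Real.exp_pos _).le, ← ENNReal.ofReal_mul (by positivity)]
          congr 1
          ring
      _ ≤ ENNReal.ofReal (2 * max K 1 * ((N : ℝ) + 1) * Real.exp (-α₀ * E)) := by
          refine ENNReal.ofReal_le_ofReal ?_
          have h1 : K ≤ 2 * max K 1 := by
            have := le_max_left K 1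
            have := le_max_right K 1
            linarith
          have h2 : 0 ≤ ((N : ℝ) + 1) * Real.exp (-α₀ * E) := by positivity
          nlinarith
  · -- (iii) the total-energy tail along the flow
    obtain ⟨-, hprod⟩ := hmom σ hσ2' N (Φ N)
    have hmeasP : Measurable fun z : Config (N + 1) (Fin 3) T3 =>
        ∏ j : Fin (N + 1), ENNReal.ofReal (Real.exp (α₀ * ‖(z j).2‖ ^ 2)) :=
      Finset.measurable_prod _ fun j _ => hmeas1 N j
    calc levelCensus σ a₀ θ₀ u₀ N (Φ N) s E
        ≤ ∫⁻ z, ((N + 1 : ℕ) : ℝ≥0∞) * (ENNReal.ofReal (Real.exp (-α₀ * E)) *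
            ∏ j : Fin (N + 1), ENNReal.ofReal (Real.exp (α₀ * ‖(z j).2‖ ^ 2)))
            ∂(localGibbsLaw σ a₀ u₀ θ₀ N (Φ N)) := by
          refine lintegral_mono_ae ?_
          filter_upwards [ae_mem_good_localGibbsLaw σ a₀ u₀ θ₀ N (Φ N)] with z hz
          exact levelCount_flow_le_prod_exp (Φ N) hz hα₀.le E s
      _ = ((N + 1 : ℕ) : ℝ≥0∞) * (ENNReal.ofReal (Real.exp (-α₀ * E)) *
            ∫⁻ z, ∏ j : Fin (N + 1), ENNReal.ofReal (Real.exp (α₀ * ‖(z j).2‖ ^ 2))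
              ∂(localGibbsLaw σ a₀ u₀ θ₀ N (Φ N))) := by
          rw [lintegral_const_mul _ (hmeasP.const_mul _), lintegral_const_mul _ hmeasP]
      _ ≤ ((N + 1 : ℕ) : ℝ≥0∞) * (ENNReal.ofReal (Real.exp (-α₀ * E)) *
            ENNReal.ofReal (K ^ (N + 1))) :=
          mul_le_mul_right (mul_le_mul_right hprod _) _
      _ = ENNReal.ofReal (((N : ℝ) + 1) * K ^ (N + 1) * Real.exp (-α₀ * E)) := by
          rw [hN, ← ENNReal.ofReal_mul (Real.exp_pos _).le, ← ENNReal.ofReal_mul (by positivity)]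
          congr 1
          ring
      _ ≤ ENNReal.ofReal ((2 * max K 1) ^ (N + 2) * Real.exp (-α₀ * E)) := by
          refine ENNReal.ofReal_le_ofReal (mul_le_mul_of_nonneg_right ?_ (Real.exp_pos _).le)
          -- `(N+1) K^{N+1} ≤ (2 max(K,1))^{N+2} = 2^{N+2} max(K,1)^{N+2}`
          have hK' : K ≤ max K 1 := le_max_left _ _
          have h1 : (1 : ℝ) ≤ max K 1 := le_max_right _ _
          have hNpow : (N : ℝ) + 1 ≤ 2 ^ (N + 2) := by
            have h := Nat.lt_two_pow_self (n := N + 1)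
            have h' : ((N + 1 : ℕ) : ℝ) ≤ ((2 ^ (N + 1) : ℕ) : ℝ) := by exact_mod_cast h.le
            push_cast at h'
            calc (N : ℝ) + 1 ≤ 2 ^ (N + 1) := h'
              _ ≤ 2 ^ (N + 2) := pow_le_pow_right₀ (by norm_num) (by omega)
          have hKpow : K ^ (N + 1) ≤ max K 1 ^ (N + 2) :=
            (pow_le_pow_left₀ hK0 hK' (N + 1)).trans (pow_le_pow_right₀ h1 (by omega))
          calc ((N : ℝ) + 1) * K ^ (N + 1) ≤ 2 ^ (N + 2) * max K 1 ^ (N + 2) :=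
                mul_le_mul hNpow hKpow (pow_nonneg hK0 _) (by positivity)
            _ = (2 * max K 1) ^ (N + 2) := by rw [mul_pow]

end Summit.AtomisticToContinuum.HydrodynamicLimit.Theorems.EnergyCurrentTailsLevelCensus
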